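import Literature.Barriers.PneNP.CorrelationPolytopeXCLowerBound
import Literature.Barriers.PneNP.ExtendedFormulationMinkowskiFaces
import Literature.Combinatorics.Optimization.CutPolytopeMinorMonotone
import Literature.Algebra.Polynomial.ThetaBodiesStableSet
import HarnessLib

/-!
# Stable set polytopes have extension complexity `2^{Ω(√n)}` (FMPTW Lemma 8, Theorem 10)

[cite: FioriniEtAl2015, §3.3, Lemma 8 and Thm. 10 (arXiv:1111.0837, pp. 9–10)]

Fiorini, Massar, Pokutta, Tiwary and de Wolf, *Exponential lower bounds for polytopes in
combinatorial optimization*, J. ACM 62 (2015), §3.3: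

* **Lemma 8.** "For each `n`, there exists a graph `H_n` with `O(n²)` vertices such that
  `STAB(H_n)` contains a face that is an extension of `COR(n)`."  The printed `H_n`: for each
  vertex `i` of `K_n` two adjacent vertices `ii, \overline{ii}`; for each edge `ij` of `K_n` a
  `4`-clique `ij, \overline{ij}, \underline{ij}, \underline{\overline{ij}}`; and eight further
  edges per edge `ij`.  "The number of vertices in `H_n` is `2n + 4·C(n,2)`."  The face `F` is cut
  out by "exactly one vertex in each vertex-clique and each edge-clique", and the projection is
  `π : ℝ^{V(H_n)} → ℝ^{n×n}`, `y_{ij} = y_{ji} = x_{ij}` (`i ≤ j`).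
* **Theorem 10.** "For all `n`, one can construct a graph `G_n` with `n` vertices such that the
  extension complexity of the stable set polytope `STAB(G_n)` is `2^{Ω(n^{1/2})}`" — `G_n` is
  `H_p` plus `n − |V(H_p)|` isolated vertices, `p` maximal with `|V(H_p)| = 2p² ≤ n`.

## What is proved (everything; no named facts)

The vertex type of `H_n` is `StabCorFace.Vert n = (Fin n × Bool) ⊕ (Edge n × (Bool × Bool))`
(`Edge n = {ij : i < j}`): `inl (i, b)` is the vertex-clique vertex standing for `b_i = b`
(`b = true` is the paper's `ii`, `false` is `\overline{ii}`) and `inr (ij, β)` the edge-clique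
vertex standing for `(b_i, b_j) = β` (`(1,1) = ij`, `(0,1) = \overline{ij}`, `(1,0) =
\underline{ij}`, `(0,0)` the fourth); the paper's eight edges are exactly
"`inr (ij, β)` is adjacent to `inl (i, ¬β₁)` and to `inl (j, ¬β₂)`" (`StabCorFace.hAdj`).

* `StabCorFace.card_vert : |V(H_n)| = 2n + 4·C(n,2)`;
* `StabCorFace.cliqueVec_dotProduct_le_one`: the clique inequalities `x(K) ≤ 1` cutting out the
  face are valid for `STAB(H_n)`;
* `StabCorFace.proj_image_face : π(F) = COR(n)` (**Lemma 8**), via the printed bijection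
  `b ↦ S_b` between `{0,1}ⁿ` and the stable sets on `F` (`eq_stableOf_of_face`,
  `proj_charVec_stableOf : π(χ^{S_b}) = b bᵀ`);
* `stab_graphH_xc_ge : xc(STAB(H_n)) ≥ (3/2)ⁿ − 1` — Lemma 8 combined with the monotonicity
  Lemma 9 (faces: `HasEFOfSize.inter_eqs`; projections: `HasEFOfSize.image_linearMap`) and the
  tree's Kaibel–Weltge form of Thm. 7, `corPolytope_xc_ge : xc(COR(n)) ≥ (3/2)ⁿ − 1`;
* `FioriniEtAl2015_thm10 : 2p² ≤ N → ∃ G on Fin N, xc(STAB(G)) ≥ (3/2)^p − 1` and the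
  `√`-form `FioriniEtAl2015_thm10_sqrt` (`p = ⌊√(N/2)⌋`), stated for the tree's
  `Literature.Combinatorics.Optimization.stabPolytope` (graphs on `Fin N`); the padding step uses
  `stab_map_inl_image` (adding isolated vertices and projecting back — the paper says "linearly
  isomorphic to a face"; projecting is the first half of its Lemma 9 and avoids the face) and the
  relabelling lemma `stab_map_equiv`.

Also `stabPolytope_eq_stab`: the tree's two stable set polytopes (`stabPolytope` on `Fin n`,
`CutPolytopeMinorMonotone`; `ThetaBodiesStableSet.stab` on any finite vertex type, BPT §7.4.1)
agree.
-/

noncomputable section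

namespace Literature.Barriers.PneNP

open Matrix Finset
open Literature.Combinatorics.Optimization (StableSets stableSetVector stabPolytope)
open Literature.Combinatorics.Optimization.FixedSizePsdRank (Cube bvec vecOuter corPolytope)
open Literature.Algebra.Polynomial (ThetaBodiesStableSet.charVec)
open Literature.Algebra.Polynomial.ThetaBodiesStableSet (stableSetVectors stab)

/-! ### The two stable set polytopes of the tree agree -/

/-- `stabPolytope G = STAB(G)` in the vocabulary of BPT §7.4.1 (`ThetaBodiesStableSet.stab`): both
are `conv{χ^S : S stable}`. [cite: FioriniEtAl2015, §3.3 (arXiv p. 9, definition of `STAB(G)`)] -/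
theorem stabPolytope_eq_stab {N : ℕ} (G : SimpleGraph (Fin N)) : stabPolytope G = stab G := by
  unfold stabPolytope stab
  congr 1
  ext x
  constructor
  · rintro ⟨S, rfl⟩
    exact ⟨S.1, fun i hi j hj _ => S.2 i hi j hj, rfl⟩
  · rintro ⟨U, hU, rfl⟩
    refine ⟨⟨U, fun i hi j hj hij => ?_⟩, rfl⟩
    by_cases h : i = j
    · subst h
      exact G.irrefl hij
    · exact hU hi hj h hij

/-! ### Relabelling and isolated vertices -/

section General

variable {V W : Type} [Fintype V] [DecidableEq V] [Fintype W] [DecidableEq W]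

omit [Fintype V] [Fintype W] in
/-- Relabelling a graph along `e : V ≃ W` transports `STAB` by the coordinate permutation
`x ↦ x ∘ e⁻¹`. [cite: FioriniEtAl2015, §3.3, proof of Thm. 10 (arXiv p. 10)] -/
theorem stab_map_equiv (G : SimpleGraph V) (e : V ≃ W) :
    stab (G.map e) = (LinearEquiv.funCongrLeft ℝ ℝ e.symm) '' stab G := by
  unfold stab
  rw [← LinearEquiv.coe_toLinearMap, LinearMap.image_convexHull]
  congr 1
  ext x
  simp only [stableSetVectors, Set.mem_setOf_eq, Set.mem_image, LinearEquiv.coe_toLinearMap]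
  constructor
  · rintro ⟨U, hU, rfl⟩
    refine ⟨ThetaBodiesStableSet.charVec (U.map e.symm.toEmbedding), ⟨U.map e.symm.toEmbedding, ?_, rfl⟩, ?_⟩
    · intro a ha b hb hab hadj
      rw [Finset.mem_coe, Finset.mem_map_equiv, Equiv.symm_symm] at ha hb
      exact hU ha hb (fun h => hab (e.injective h)) (SimpleGraph.map_adj_apply' hadj
        (fun h => hab (e.injective h)))
    · funext w
      simp [ThetaBodiesStableSet.charVec, LinearEquiv.funCongrLeft_apply, LinearMap.funLeft_apply]
  · rintro ⟨_, ⟨U, hU, rfl⟩, rfl⟩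
    refine ⟨U.map e.toEmbedding, ?_, ?_⟩
    · intro a ha b hb hab hadj
      rw [Finset.mem_coe, Finset.mem_map_equiv] at ha hb
      rw [SimpleGraph.map_adj'] at hadj
      obtain ⟨-, a', b', hadj', rfl, rfl⟩ := hadj
      rw [Equiv.symm_apply_apply] at ha hb
      exact hU ha hb (fun h => hab (by rw [h])) hadj'
    · funext w
      simp [ThetaBodiesStableSet.charVec, LinearEquiv.funCongrLeft_apply, LinearMap.funLeft_apply,
        Finset.mem_map_equiv]

/-- Adding isolated vertices (`G ↦ G.map inl` on `V ⊕ K`) and projecting back onto the old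
coordinates recovers `STAB(G)`: `STAB(G)` is a projection of `STAB(G + isolated vertices)`.
[cite: FioriniEtAl2015, §3.3, proof of Thm. 10 (arXiv p. 10)] -/
theorem stab_map_inl_image (G : SimpleGraph V) (K : Type) [Fintype K] [DecidableEq K] :
    (LinearMap.funLeft ℝ ℝ (Sum.inl : V → V ⊕ K)) '' stab (G.map Sum.inl) = stab G := by
  unfold stab
  rw [LinearMap.image_convexHull]
  congr 1
  ext x
  simp only [stableSetVectors, Set.mem_setOf_eq, Set.mem_image]
  constructor
  · rintro ⟨_, ⟨U', hU', rfl⟩, rfl⟩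
    refine ⟨univ.filter fun v => (Sum.inl v : V ⊕ K) ∈ U', ?_, ?_⟩
    · intro a ha b hb hab hadj
      simp only [Finset.coe_filter, Finset.mem_univ, true_and, Set.mem_setOf_eq] at ha hb
      exact hU' ha hb (fun h => hab (Sum.inl_injective h))
        (SimpleGraph.map_adj_apply' hadj (fun h => hab (Sum.inl_injective h)))
    · funext v
      simp [ThetaBodiesStableSet.charVec, LinearMap.funLeft_apply]
  · rintro ⟨U, hU, rfl⟩
    refine ⟨ThetaBodiesStableSet.charVec (U.map Function.Embedding.inl), ⟨U.map Function.Embedding.inl, ?_, rfl⟩, ?_⟩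
    · intro a ha b hb hab hadj
      rw [SimpleGraph.map_adj'] at hadj
      obtain ⟨-, a', b', hadj', rfl, rfl⟩ := hadj
      rw [Finset.mem_coe] at ha hb
      have ha' : a' ∈ U := by simpa using ha
      have hb' : b' ∈ U := by simpa using hb
      exact hU ha' hb' (fun h => hab (by rw [h])) hadj'
    · funext v
      simp [ThetaBodiesStableSet.charVec, LinearMap.funLeft_apply]

/-- Monotonicity under adding isolated vertices: an extended formulation of
`STAB(G + isolated vertices)` of size `r` yields one of `STAB(G)` (FMPTW Lemma 9, first part,
applied to the projection of `stab_map_inl_image`).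
[cite: FioriniEtAl2015, §3.3, Lemma 9 and proof of Thm. 10 (arXiv p. 10)] -/
theorem HasEFOfSize.of_stab_map_inl (G : SimpleGraph V) (K : Type) [Fintype K] [DecidableEq K]
    {r : ℕ} (h : HasEFOfSize (stab (G.map (Sum.inl : V → V ⊕ K))) r) :
    HasEFOfSize (stab G) r := by
  have := h.image_linearMap (LinearMap.funLeft ℝ ℝ (Sum.inl : V → V ⊕ K))
  rwa [stab_map_inl_image] at this

/-- Relabelling invariance of extension complexity of stable set polytopes.
[cite: FioriniEtAl2015, §3.3, proof of Thm. 10 (arXiv p. 10)] -/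
theorem hasEFOfSize_stab_map_equiv_iff (G : SimpleGraph V) (e : V ≃ W) {r : ℕ} :
    HasEFOfSize (stab (G.map e)) r ↔ HasEFOfSize (stab G) r := by
  rw [stab_map_equiv, HasEFOfSize.image_linearEquiv_iff]

end General

/-! ### The graph `H_n` -/

namespace StabCorFace

variable (n : ℕ)

/-- The edges `ij`, `i < j`, of `K_n`. [cite: FioriniEtAl2015, §3.3, proof of Lemma 8] -/
abbrev Edge : Type := {p : Fin n × Fin n // p.1 < p.2}

/-- The vertex set of `H_n`: `inl (i, b)` (`b ∈ {0,1}`) are the two vertices `ii, \overline{ii}`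
of the vertex-clique of `i`, `inr (ij, β)` (`β ∈ {0,1}²`) the four vertices of the edge-clique of
`ij`. [cite: FioriniEtAl2015, §3.3, proof of Lemma 8 (arXiv p. 9)] -/
abbrev Vert : Type := (Fin n × Bool) ⊕ (Edge n × (Bool × Bool))

variable {n}

/-- Adjacency of `H_n`: the vertex-cliques, the edge-cliques, and the eight edges joining
`inr (ij, β)` to `inl (i, ¬β₁)` and `inl (j, ¬β₂)` (`{ij, \overline{ii}}, {ij, \overline{jj}},
{\overline{ij}, ii}, {\overline{ij}, \overline{jj}}, …`).
[cite: FioriniEtAl2015, §3.3, proof of Lemma 8 (arXiv pp. 9–10)] -/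
def hAdj : Vert n → Vert n → Prop
  | .inl (i, b), .inl (i', b') => i = i' ∧ b ≠ b'
  | .inr (p, β), .inr (p', β') => p = p' ∧ β ≠ β'
  | .inl (i, b), .inr (p, β) => (p.1.1 = i ∧ β.1 ≠ b) ∨ (p.1.2 = i ∧ β.2 ≠ b)
  | .inr (p, β), .inl (i, b) => (p.1.1 = i ∧ β.1 ≠ b) ∨ (p.1.2 = i ∧ β.2 ≠ b)

/-- `hAdj` is symmetric. [cite: FioriniEtAl2015, §3.3, proof of Lemma 8] -/
theorem hAdj_symm (v w : Vert n) (h : hAdj v w) : hAdj w v := by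
  rcases v with ⟨i, b⟩ | ⟨p, β⟩ <;> rcases w with ⟨i', b'⟩ | ⟨p', β'⟩ <;>
    simp only [hAdj] at h ⊢
  · exact ⟨h.1.symm, Ne.symm h.2⟩
  · exact h
  · exact h
  · exact ⟨h.1.symm, Ne.symm h.2⟩

/-- `hAdj` is irreflexive. [cite: FioriniEtAl2015, §3.3, proof of Lemma 8] -/
theorem hAdj_irrefl (v : Vert n) : ¬ hAdj v v := by
  rcases v with ⟨i, b⟩ | ⟨p, β⟩ <;> simp [hAdj]

variable (n) in
/-- The graph `H_n`. [cite: FioriniEtAl2015, §3.3, proof of Lemma 8 (arXiv pp. 9–10)] -/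
def graphH : SimpleGraph (Vert n) where
  Adj := hAdj
  symm := ⟨hAdj_symm⟩
  loopless := ⟨hAdj_irrefl⟩

/-- The vertex-clique edges `{ii, \overline{ii}}`. [cite: FioriniEtAl2015, §3.3, proof of Lemma 8] -/
theorem adj_inl_inl {i i' : Fin n} {b b' : Bool} :
    (graphH n).Adj (.inl (i, b)) (.inl (i', b')) ↔ i = i' ∧ b ≠ b' := Iff.rfl

/-- The edge-clique edges (all six edges among the four vertices of `ij`).
[cite: FioriniEtAl2015, §3.3, proof of Lemma 8] -/
theorem adj_inr_inr {p p' : Edge n} {β β' : Bool × Bool} :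
    (graphH n).Adj (.inr (p, β)) (.inr (p', β')) ↔ p = p' ∧ β ≠ β' := Iff.rfl

/-- The eight edges between the edge-clique of `ij` and the vertex-cliques of `i`, `j`.
[cite: FioriniEtAl2015, §3.3, proof of Lemma 8 (arXiv p. 10)] -/
theorem adj_inl_inr {i : Fin n} {b : Bool} {p : Edge n} {β : Bool × Bool} :
    (graphH n).Adj (.inl (i, b)) (.inr (p, β)) ↔
      (p.1.1 = i ∧ β.1 ≠ b) ∨ (p.1.2 = i ∧ β.2 ≠ b) := Iff.rfl

/-- The eight edges between the edge-clique of `ij` and the vertex-cliques of `i`, `j`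
(symmetric form). [cite: FioriniEtAl2015, §3.3, proof of Lemma 8 (arXiv p. 10)] -/
theorem adj_inr_inl {i : Fin n} {b : Bool} {p : Edge n} {β : Bool × Bool} :
    (graphH n).Adj (.inr (p, β)) (.inl (i, b)) ↔
      (p.1.1 = i ∧ β.1 ≠ b) ∨ (p.1.2 = i ∧ β.2 ≠ b) := Iff.rfl

/-- `|E(K_n)| = C(n,2)`. [cite: FioriniEtAl2015, §3.3, proof of Lemma 8] -/
theorem card_edge (n : ℕ) : Fintype.card (Edge n) = n.choose 2 := by
  rw [Fintype.card_subtype, Finset.card_eq_sum_ones, Finset.sum_filter,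
    ← Finset.univ_product_univ, Finset.sum_product_right]
  have h1 : ∀ j : Fin n, (∑ i : Fin n, if i < j then 1 else 0) = (j : ℕ) := by
    intro j
    rw [Finset.sum_boole, Nat.cast_id, Finset.filter_gt_eq_Iio, Fin.card_Iio]
  simp_rw [h1]
  rw [Fin.sum_univ_eq_sum_range (fun j => j) n, Finset.sum_range_id, Nat.choose_two_right]

/-- "The number of vertices in `H_n` is `2n + 4·C(n,2)`."
[cite: FioriniEtAl2015, §3.3, proof of Lemma 8 (arXiv p. 10)] -/
theorem card_vert (n : ℕ) : Fintype.card (Vert n) = 2 * n + 4 * n.choose 2 := by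
  rw [Fintype.card_sum, Fintype.card_prod, Fintype.card_prod, Fintype.card_fin,
    Fintype.card_bool, card_edge, Fintype.card_prod, Fintype.card_bool]
  ring

/-- `|V(H_n)| = 2n²`. [cite: FioriniEtAl2015, §3.3, proof of Lemma 8 (arXiv p. 10)] -/
theorem card_vert_eq_two_mul_sq (n : ℕ) : Fintype.card (Vert n) = 2 * n ^ 2 := by
  rw [card_vert, Nat.choose_two_right]
  rcases Nat.even_or_odd n with ⟨k, rfl⟩ | ⟨k, rfl⟩
  · rw [show (k + k) * (k + k - 1) = (k * (k + k - 1)) * 2 by ring, Nat.mul_div_cancel _ two_pos]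
    rcases k with _ | k
    · simp
    · rw [show k + 1 + (k + 1) - 1 = 2 * k + 1 from by omega]
      ring
  · rw [show (2 * k + 1) * (2 * k + 1 - 1) = ((2 * k + 1) * k) * 2 by
      rw [Nat.add_sub_cancel]; ring, Nat.mul_div_cancel _ two_pos]
    ring

/-! ### Cliques, the face `F`, the projection `π` -/

/-- The clique a vertex of `H_n` lies in: vertex-clique `inl i` or edge-clique `inr ij`.
[cite: FioriniEtAl2015, §3.3, proof of Lemma 8 ("vertex-cliques and edge-cliques")] -/
def cliqueOf : Vert n → Fin n ⊕ Edge n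
  | .inl (i, _) => .inl i
  | .inr (p, _) => .inr p

/-- Two distinct vertices of the same clique are adjacent.
[cite: FioriniEtAl2015, §3.3, proof of Lemma 8] -/
theorem adj_of_cliqueOf_eq {v w : Vert n} (h : cliqueOf v = cliqueOf w) (hne : v ≠ w) :
    (graphH n).Adj v w := by
  rcases v with ⟨i, b⟩ | ⟨p, β⟩ <;> rcases w with ⟨i', b'⟩ | ⟨p', β'⟩ <;>
    simp only [cliqueOf, Sum.inl.injEq, Sum.inr.injEq, reduceCtorEq] at h
  · subst h
    exact adj_inl_inl.mpr ⟨rfl, fun hb => hne (by rw [hb])⟩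
  · subst h
    exact adj_inr_inr.mpr ⟨rfl, fun hb => hne (by rw [hb])⟩

/-- The normal vector of the clique inequality `x(K_t) ≤ 1` of the clique `t`.
[cite: FioriniEtAl2015, §3.3, proof of Lemma 8] -/
def cliqueVec (t : Fin n ⊕ Edge n) : Vert n → ℝ := fun v => if cliqueOf v = t then 1 else 0

/-- `⟨cliqueVec t, χ^U⟩ = |U ∩ K_t|`. [cite: FioriniEtAl2015, §3.3, proof of Lemma 8] -/
theorem cliqueVec_dotProduct_charVec (t : Fin n ⊕ Edge n) (U : Finset (Vert n)) :
    cliqueVec t ⬝ᵥ ThetaBodiesStableSet.charVec U = ((univ.filter fun v => v ∈ U ∧ cliqueOf v = t).card : ℝ) := by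
  rw [← Finset.sum_boole]
  unfold dotProduct cliqueVec ThetaBodiesStableSet.charVec
  refine Finset.sum_congr rfl fun v _ => ?_
  by_cases h1 : cliqueOf v = t <;> by_cases h2 : v ∈ U <;> simp [h1, h2]

/-- A stable set meets each clique in at most one vertex.
[cite: FioriniEtAl2015, §3.3, proof of Lemma 8] -/
theorem card_filter_le_one {U : Finset (Vert n)} (hU : (graphH n).IsIndepSet (U : Set (Vert n)))
    (t : Fin n ⊕ Edge n) : (univ.filter fun v => v ∈ U ∧ cliqueOf v = t).card ≤ 1 := by
  rw [Finset.card_le_one]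
  intro a ha b hb
  simp only [Finset.mem_filter, Finset.mem_univ, true_and] at ha hb
  by_contra hab
  exact hU ha.1 hb.1 hab (adj_of_cliqueOf_eq (ha.2.trans hb.2.symm) hab)

/-- The clique inequalities hold at stable-set vectors.
[cite: FioriniEtAl2015, §3.3, proof of Lemma 8] -/
theorem cliqueVec_dotProduct_charVec_le_one {U : Finset (Vert n)}
    (hU : (graphH n).IsIndepSet (U : Set (Vert n))) (t : Fin n ⊕ Edge n) :
    cliqueVec t ⬝ᵥ ThetaBodiesStableSet.charVec U ≤ 1 := by
  rw [cliqueVec_dotProduct_charVec]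
  exact_mod_cast card_filter_le_one hU t

/-- The clique inequalities `x(K_t) ≤ 1` are valid for `STAB(H_n)` (so the set `F` below is a
face). [cite: FioriniEtAl2015, §3.3, proof of Lemma 8 (arXiv p. 10: "the face `F`")] -/
theorem cliqueVec_dotProduct_le_one (t : Fin n ⊕ Edge n) {x : Vert n → ℝ}
    (hx : x ∈ stab (graphH n)) : cliqueVec t ⬝ᵥ x ≤ 1 := by
  have hconv : Convex ℝ {y : Vert n → ℝ | cliqueVec t ⬝ᵥ y ≤ 1} := by
    refine convex_halfSpace_le ⟨fun y z => dotProduct_add _ _ _, fun c y => ?_⟩ 1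
    rw [dotProduct_smul, smul_eq_mul]
  refine (convexHull_min ?_ hconv) hx
  rintro y ⟨U, hU, rfl⟩
  exact cliqueVec_dotProduct_charVec_le_one hU t

variable (n) in
/-- The face `F = F(n)` of `STAB(H_n)` "whose vertices correspond to the stable sets containing
exactly one vertex in each vertex-clique and each edge-clique".
[cite: FioriniEtAl2015, §3.3, proof of Lemma 8 (arXiv p. 10)] -/
def face : Set (Vert n → ℝ) := stab (graphH n) ∩ {x | ∀ t, cliqueVec t ⬝ᵥ x = 1}

/-- The vertex `x_{ij}` of `H_n` read off at the matrix position `(i, j)`: `ij` (the `(1,1)`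
edge-clique vertex) for `i ≠ j`, `ii` for `i = j`.
[cite: FioriniEtAl2015, §3.3, proof of Lemma 8 (arXiv p. 10, the map `π`)] -/
def sel (i j : Fin n) : Vert n :=
  if hij : i < j then .inr (⟨(i, j), hij⟩, (true, true))
  else if hji : j < i then .inr (⟨(j, i), hji⟩, (true, true))
  else .inl (i, true)

variable (n) in
/-- The projection `π : ℝ^{V(H_n)} → ℝ^{n × n}`, `y_{ij} = y_{ji} = x_{ij}` for `i ≤ j`.
[cite: FioriniEtAl2015, §3.3, proof of Lemma 8 (arXiv p. 10)] -/
def proj : (Vert n → ℝ) →ₗ[ℝ] (Fin (n * n) → ℝ) :=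
  LinearMap.funLeft ℝ ℝ fun q => sel (finProdFinEquiv.symm q).1 (finProdFinEquiv.symm q).2

/-- `(π x)_{ij} = x_{ij}`. [cite: FioriniEtAl2015, §3.3, proof of Lemma 8 (arXiv p. 10)] -/
theorem proj_apply (x : Vert n → ℝ) (q : Fin (n * n)) :
    proj n x q = x (sel (finProdFinEquiv.symm q).1 (finProdFinEquiv.symm q).2) := rfl

/-! ### The maximum stable sets `S_b` -/

/-- Membership test of the stable set `S_b` attached to `b ∈ {0,1}ⁿ`: `ii ∈ S_b` iff `b_i = 1`,
`\overline{ii} ∈ S_b` iff `b_i = 0`, and the edge-clique vertex of `ij` standing for `(b_i, b_j)`.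
[cite: FioriniEtAl2015, §3.3, proof of Lemma 8 (arXiv p. 10: "the unique maximum stable set")] -/
def inS (b : Cube n) : Vert n → Bool
  | .inl (i, c) => decide (c = b i)
  | .inr (p, β) => decide (β = (b p.1.1, b p.1.2))

/-- The stable set `S_b`. [cite: FioriniEtAl2015, §3.3, proof of Lemma 8 (arXiv p. 10)] -/
def stableOf (b : Cube n) : Finset (Vert n) := univ.filter fun v => inS b v = true

/-- `ii ∈ S_b ↔ b_i = 1`, `\overline{ii} ∈ S_b ↔ b_i = 0`.
[cite: FioriniEtAl2015, §3.3, proof of Lemma 8 (arXiv p. 10)] -/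
@[simp] theorem mem_stableOf_inl (b : Cube n) (i : Fin n) (c : Bool) :
    (Sum.inl (i, c) : Vert n) ∈ stableOf b ↔ c = b i := by
  simp [stableOf, inS]

/-- The edge-clique vertex of `ij` in `S_b` is the one standing for `(b_i, b_j)`.
[cite: FioriniEtAl2015, §3.3, proof of Lemma 8 (arXiv p. 10)] -/
@[simp] theorem mem_stableOf_inr (b : Cube n) (p : Edge n) (β : Bool × Bool) :
    (Sum.inr (p, β) : Vert n) ∈ stableOf b ↔ β = (b p.1.1, b p.1.2) := by
  simp [stableOf, inS]

/-- `S_b` is a stable set of `H_n`. [cite: FioriniEtAl2015, §3.3, proof of Lemma 8] -/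
theorem stableOf_isIndepSet (b : Cube n) :
    (graphH n).IsIndepSet (stableOf b : Set (Vert n)) := by
  intro v hv w hw _ hadj
  rw [Finset.mem_coe] at hv hw
  rcases v with ⟨i, c⟩ | ⟨p, β⟩ <;> rcases w with ⟨i', c'⟩ | ⟨p', β'⟩
  · rw [mem_stableOf_inl] at hv hw
    rw [adj_inl_inl] at hadj
    obtain ⟨rfl, hcc⟩ := hadj
    exact hcc (hv.trans hw.symm)
  · rw [mem_stableOf_inl] at hv
    rw [mem_stableOf_inr] at hw
    rw [adj_inl_inr, hw] at hadj
    rcases hadj with ⟨rfl, h⟩ | ⟨rfl, h⟩ <;> exact h hv.symm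
  · rw [mem_stableOf_inr] at hv
    rw [mem_stableOf_inl] at hw
    rw [adj_inr_inl, hv] at hadj
    rcases hadj with ⟨rfl, h⟩ | ⟨rfl, h⟩ <;> exact h hw.symm
  · rw [mem_stableOf_inr] at hv hw
    rw [adj_inr_inr] at hadj
    obtain ⟨rfl, hββ⟩ := hadj
    exact hββ (hv.trans hw.symm)

/-- `S_b` meets the vertex-clique of `i` exactly in `inl (i, b_i)`.
[cite: FioriniEtAl2015, §3.3, proof of Lemma 8] -/
theorem filter_stableOf_inl (b : Cube n) (i : Fin n) :
    (univ.filter fun v => v ∈ stableOf b ∧ cliqueOf v = Sum.inl i) =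
      {(Sum.inl (i, b i) : Vert n)} := by
  ext v
  simp only [Finset.mem_filter, Finset.mem_univ, true_and, Finset.mem_singleton]
  rcases v with ⟨i', c⟩ | ⟨p, β⟩
  · rw [mem_stableOf_inl]
    simp only [cliqueOf, Sum.inl.injEq, Prod.mk.injEq]
    constructor
    · rintro ⟨rfl, rfl⟩
      exact ⟨rfl, rfl⟩
    · rintro ⟨rfl, rfl⟩
      exact ⟨rfl, rfl⟩
  · simp [cliqueOf]

/-- `S_b` meets the edge-clique of `ij` exactly in the vertex standing for `(b_i, b_j)`.
[cite: FioriniEtAl2015, §3.3, proof of Lemma 8] -/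
theorem filter_stableOf_inr (b : Cube n) (p : Edge n) :
    (univ.filter fun v => v ∈ stableOf b ∧ cliqueOf v = Sum.inr p) =
      {(Sum.inr (p, (b p.1.1, b p.1.2)) : Vert n)} := by
  ext v
  simp only [Finset.mem_filter, Finset.mem_univ, true_and, Finset.mem_singleton]
  rcases v with ⟨i', c⟩ | ⟨p', β⟩
  · simp [cliqueOf]
  · rw [mem_stableOf_inr]
    simp only [cliqueOf, Sum.inr.injEq, Prod.mk.injEq]
    constructor
    · rintro ⟨rfl, rfl⟩
      exact ⟨rfl, rfl⟩
    · rintro ⟨rfl, rfl⟩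
      exact ⟨rfl, rfl⟩

/-- `χ^{S_b}` lies on the face `F`: it meets every clique exactly once.
[cite: FioriniEtAl2015, §3.3, proof of Lemma 8] -/
theorem cliqueVec_dotProduct_stableOf (b : Cube n) (t : Fin n ⊕ Edge n) :
    cliqueVec t ⬝ᵥ ThetaBodiesStableSet.charVec (stableOf b) = 1 := by
  rw [cliqueVec_dotProduct_charVec]
  rcases t with i | p
  · rw [filter_stableOf_inl, Finset.card_singleton, Nat.cast_one]
  · rw [filter_stableOf_inr, Finset.card_singleton, Nat.cast_one]

/-- `χ^{S_b} ∈ F`. [cite: FioriniEtAl2015, §3.3, proof of Lemma 8] -/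
theorem charVec_stableOf_mem_face (b : Cube n) : ThetaBodiesStableSet.charVec (stableOf b) ∈ face n :=
  ⟨subset_convexHull ℝ _ ⟨stableOf b, stableOf_isIndepSet b, rfl⟩,
    fun t => cliqueVec_dotProduct_stableOf b t⟩

/-- "`ij ∈ S` if and only if both vertices `ii` and `jj` belong to `S`": the coordinate of
`χ^{S_b}` read at position `(i, j)` is `b_i b_j`.
[cite: FioriniEtAl2015, §3.3, proof of Lemma 8 (arXiv p. 10)] -/
theorem charVec_stableOf_sel (b : Cube n) (i j : Fin n) :
    ThetaBodiesStableSet.charVec (stableOf b) (sel i j) = bvec b i * bvec b j := by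
  unfold sel
  split_ifs with hij hji
  · simp only [ThetaBodiesStableSet.charVec, mem_stableOf_inr, Prod.mk.injEq, bvec]
    rcases Bool.eq_false_or_eq_true (b i) with hi | hi <;>
      rcases Bool.eq_false_or_eq_true (b j) with hj | hj <;> simp [hi, hj]
  · simp only [ThetaBodiesStableSet.charVec, mem_stableOf_inr, Prod.mk.injEq, bvec]
    rcases Bool.eq_false_or_eq_true (b i) with hi | hi <;>
      rcases Bool.eq_false_or_eq_true (b j) with hj | hj <;> simp [hi, hj]
  · obtain rfl : i = j := le_antisymm (not_lt.mp hji) (not_lt.mp hij)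
    simp only [ThetaBodiesStableSet.charVec, mem_stableOf_inl, bvec]
    rcases Bool.eq_false_or_eq_true (b i) with hi | hi <;> simp [hi]

/-- `π(χ^{S_b}) = b bᵀ`. [cite: FioriniEtAl2015, §3.3, proof of Lemma 8 (arXiv p. 10)] -/
theorem proj_charVec_stableOf (b : Cube n) :
    proj n (ThetaBodiesStableSet.charVec (stableOf b)) = vecOuter n (bvec b) := by
  funext q
  rw [proj_apply, charVec_stableOf_sel]
  rfl

/-- The bit string `b(S)` of a stable set `S`: "`b_i := 1` if `ii ∈ S` and `b_i := 0` otherwise".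
[cite: FioriniEtAl2015, §3.3, proof of Lemma 8 (arXiv p. 10)] -/
def bitsOf (U : Finset (Vert n)) : Cube n := fun i => decide ((Sum.inl (i, true) : Vert n) ∈ U)

/-- A stable set on the face `F` (exactly one vertex in each clique) is `S_{b(S)}`.
[cite: FioriniEtAl2015, §3.3, proof of Lemma 8 (arXiv p. 10)] -/
theorem eq_stableOf_of_face {U : Finset (Vert n)} (hU : (graphH n).IsIndepSet (U : Set (Vert n)))
    (hF : ∀ t, cliqueVec t ⬝ᵥ ThetaBodiesStableSet.charVec U = 1) : U = stableOf (bitsOf U) := by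
  -- each clique meets `U` in exactly one vertex
  have h1 : ∀ t, ∃ a, a ∈ U ∧ cliqueOf a = t := fun t => by
    have ht := hF t
    rw [cliqueVec_dotProduct_charVec, Nat.cast_eq_one, Finset.card_eq_one] at ht
    obtain ⟨a, ha⟩ := ht
    have : a ∈ univ.filter fun v => v ∈ U ∧ cliqueOf v = t := by
      rw [ha]; exact Finset.mem_singleton_self a
    exact ⟨a, (Finset.mem_filter.mp this).2⟩
  -- no two distinct vertices of `U` share a clique
  have h2 : ∀ v ∈ U, ∀ w ∈ U, cliqueOf v = cliqueOf w → v = w := fun v hv w hw hc => by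
    by_contra hne
    exact hU hv hw hne (adj_of_cliqueOf_eq hc hne)
  -- the vertex-clique of `i` meets `U` in `inl (i, b_i)`
  have h3 : ∀ i, (Sum.inl (i, bitsOf U i) : Vert n) ∈ U := fun i => by
    obtain ⟨a, haU, hac⟩ := h1 (Sum.inl i)
    rcases a with ⟨i', c⟩ | ⟨p, β⟩
    · simp only [cliqueOf, Sum.inl.injEq] at hac
      subst hac
      rcases Bool.eq_false_or_eq_true c with rfl | rfl
      · have hb : bitsOf U i' = true := by simp [bitsOf, haU]
        rwa [hb]
      · have hnot : (Sum.inl (i', true) : Vert n) ∉ U := fun ht => by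
          have := h2 _ ht _ haU rfl
          simp at this
        have hb : bitsOf U i' = false := by simp [bitsOf, hnot]
        rwa [hb]
    · simp [cliqueOf] at hac
  -- edge-clique vertices of `U` carry the bits
  have key : ∀ (p : Edge n) (β : Bool × Bool), (Sum.inr (p, β) : Vert n) ∈ U →
      β = (bitsOf U p.1.1, bitsOf U p.1.2) := by
    intro p β hβ
    have n1 : ¬ (graphH n).Adj (Sum.inr (p, β)) (Sum.inl (p.1.1, bitsOf U p.1.1)) :=
      fun h => hU hβ (h3 p.1.1) (by simp) h
    have n2 : ¬ (graphH n).Adj (Sum.inr (p, β)) (Sum.inl (p.1.2, bitsOf U p.1.2)) :=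
      fun h => hU hβ (h3 p.1.2) (by simp) h
    rw [adj_inr_inl] at n1 n2
    have e1 : β.1 = bitsOf U p.1.1 := by
      by_contra hne
      exact n1 (Or.inl ⟨rfl, hne⟩)
    have e2 : β.2 = bitsOf U p.1.2 := by
      by_contra hne
      exact n2 (Or.inr ⟨rfl, hne⟩)
    exact Prod.ext e1 e2
  ext v
  rcases v with ⟨i, c⟩ | ⟨p, β⟩
  · rw [mem_stableOf_inl]
    constructor
    · intro hv
      have := h2 _ hv _ (h3 i) rfl
      simpa using this
    · rintro rfl
      exact h3 i
  · rw [mem_stableOf_inr]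
    refine ⟨key p β, ?_⟩
    rintro rfl
    obtain ⟨a, haU, hac⟩ := h1 (Sum.inr p)
    rcases a with ⟨i', c⟩ | ⟨p', β'⟩
    · simp [cliqueOf] at hac
    · simp only [cliqueOf, Sum.inr.injEq] at hac
      subst hac
      rwa [← key p' β' haU]

/-! ### Lemma 8: `π(F) = COR(n)` -/

/-- **FMPTW Lemma 8** (the computation): the image of the face `F` of `STAB(H_n)` under `π` is
the correlation polytope `COR(n) = conv{b bᵀ : b ∈ {0,1}ⁿ}`.
[cite: FioriniEtAl2015, §3.3, Lemma 8 (arXiv pp. 9–10)] -/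
theorem proj_image_face (n : ℕ) : proj n '' face n = corPolytope n := by
  classical
  -- `STAB(H_n)` as the hull of a finite set
  set S : Finset (Vert n → ℝ) := (univ.filter fun U : Finset (Vert n) =>
      (graphH n).IsIndepSet (U : Set (Vert n))).image ThetaBodiesStableSet.charVec with hS
  have hstab : stab (graphH n) = convexHull ℝ (S : Set (Vert n → ℝ)) := by
    unfold stab
    congr 1
    ext x
    simp only [stableSetVectors, Set.mem_setOf_eq, hS, Finset.coe_image, Finset.coe_filter,
      Finset.mem_univ, true_and, Set.mem_image, Set.mem_setOf_eq]
    constructor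
    · rintro ⟨U, hU, rfl⟩
      exact ⟨U, hU, rfl⟩
    · rintro ⟨U, hU, rfl⟩
      exact ⟨U, hU, rfl⟩
  have hval : ∀ t, ∀ x ∈ convexHull ℝ (S : Set (Vert n → ℝ)),
      cliqueVec t ⬝ᵥ x ≤ (fun _ => (1 : ℝ)) t := by
    intro t x hx
    rw [← hstab] at hx
    exact cliqueVec_dotProduct_le_one t hx
  -- `F` is the hull of the stable-set vectors on it
  have hface : face n = convexHull ℝ ((S.filter fun s =>
      (∑ t, cliqueVec t) ⬝ᵥ s = ∑ _t : Fin n ⊕ Edge n, (1 : ℝ)) : Set (Vert n → ℝ)) := by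
    unfold face
    rw [hstab, inter_eqs_eq_inter_sum_of_valid _ cliqueVec (fun _ => 1) hval,
      convexHull_inter_dotProduct_eq_of_valid]
    exact sum_dotProduct_le_sum_of_valid _ cliqueVec (fun _ => 1)
      (fun t s hs => hval t s (subset_convexHull ℝ _ hs))
  -- … and these are exactly the `χ^{S_b}`
  have hfilt : ((S.filter fun s =>
      (∑ t, cliqueVec t) ⬝ᵥ s = ∑ _t : Fin n ⊕ Edge n, (1 : ℝ)) : Set (Vert n → ℝ)) =
      Set.range fun b : Cube n => ThetaBodiesStableSet.charVec (stableOf b) := by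
    ext s
    simp only [Finset.coe_filter, Set.mem_setOf_eq, Set.mem_range, hS, Finset.mem_image,
      Finset.mem_filter, Finset.mem_univ, true_and]
    constructor
    · rintro ⟨⟨U, hU, rfl⟩, hsum⟩
      refine ⟨bitsOf U, ?_⟩
      rw [← eq_stableOf_of_face hU]
      intro t
      have hle : ∀ t ∈ (univ : Finset (Fin n ⊕ Edge n)), cliqueVec t ⬝ᵥ ThetaBodiesStableSet.charVec U ≤ 1 :=
        fun t _ => cliqueVec_dotProduct_charVec_le_one hU t
      rw [sum_dotProduct] at hsum
      exact (Finset.sum_eq_sum_iff_of_le hle).mp hsum t (mem_univ t)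
    · rintro ⟨b, rfl⟩
      refine ⟨⟨stableOf b, stableOf_isIndepSet b, rfl⟩, ?_⟩
      rw [sum_dotProduct]
      exact Finset.sum_congr rfl fun t _ => cliqueVec_dotProduct_stableOf b t
  rw [hface, LinearMap.image_convexHull, hfilt, ← Set.range_comp]
  have hcomp : ((proj n) ∘ fun b : Cube n => ThetaBodiesStableSet.charVec (stableOf b)) =
      fun a : Cube n => vecOuter n (bvec a) :=
    funext fun b => proj_charVec_stableOf b
  rw [hcomp]
  rfl

/-- **FMPTW Lemma 8**, as printed: `H_n` has `2n + 4·C(n,2) = O(n²)` vertices, the clique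
inequalities cutting out `F` are valid for `STAB(H_n)` (so `F` is a face), and `π(F) = COR(n)`
(`F` is an extension of `COR(n)`). [cite: FioriniEtAl2015, §3.3, Lemma 8 (arXiv pp. 9–10)] -/
theorem _root_.Literature.Barriers.PneNP.FioriniEtAl2015_lemma8 (n : ℕ) :
    Fintype.card (Vert n) = 2 * n + 4 * n.choose 2 ∧
      (∀ t, ∀ x ∈ stab (graphH n), cliqueVec t ⬝ᵥ x ≤ 1) ∧
      proj n '' (stab (graphH n) ∩ {x | ∀ t, cliqueVec t ⬝ᵥ x = 1}) = corPolytope n :=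
  ⟨card_vert n, fun t _ hx => cliqueVec_dotProduct_le_one t hx, proj_image_face n⟩

end StabCorFace

open StabCorFace

/-- `xc(STAB(H_n)) ≥ xc(COR(n))`: every size-`r` extended formulation of `STAB(H_n)` yields one
of `COR(n)` (Lemma 8 with the two monotonicity rules of Lemma 9), hence `(3/2)ⁿ ≤ r + 1` by the
Kaibel–Weltge form of Thm. 7 (`corPolytope_xc_ge`).
[cite: FioriniEtAl2015, §3.3, Lemmas 8–9 and Thm. 7 (arXiv pp. 9–10)] -/
theorem stab_graphH_xc_ge {n r : ℕ} (h : HasEFOfSize (stab (graphH n)) r) :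
    (3 / 2 : ℝ) ^ n ≤ r + 1 := by
  have h1 := (h.inter_eqs cliqueVec fun _ => (1 : ℝ)).image_linearMap (proj n)
  have h2 : HasEFOfSize (proj n '' face n) r := h1
  rw [proj_image_face] at h2
  exact corPolytope_xc_ge h2

/-- An extended formulation of `COR(n)` of the size of any one of `STAB(H_n)` ("`STAB(H_n)`
contains a face that is an extension of `COR(n)`", in the currency of `HasEFOfSize`).
[cite: FioriniEtAl2015, §3.3, Lemmas 8–9 (arXiv p. 10)] -/
theorem HasEFOfSize.corPolytope_of_stab_graphH {n r : ℕ} (h : HasEFOfSize (stab (graphH n)) r) :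
    HasEFOfSize (corPolytope n) r := by
  have h1 := (h.inter_eqs cliqueVec fun _ => (1 : ℝ)).image_linearMap (proj n)
  have h2 : HasEFOfSize (proj n '' face n) r := h1
  rwa [proj_image_face] at h2

/-! ### Theorem 10: `n`-vertex graphs with `xc(STAB(G_n)) = 2^{Ω(√n)}` -/

/-- **FMPTW Theorem 10** (explicit form). For `2p² ≤ N` there is a graph `G` on `N` vertices —
`H_p` plus `N − 2p²` isolated vertices, relabelled to `Fin N` — all of whose extended formulations
have size `r ≥ (3/2)^p − 1`; with `p = ⌊√(N/2)⌋` this is `xc(STAB(G_N)) = 2^{Ω(√N)}`.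
[cite: FioriniEtAl2015, §3.3, Thm. 10 (arXiv p. 10)] -/
theorem FioriniEtAl2015_thm10 {p N : ℕ} (hN : 2 * p ^ 2 ≤ N) :
    ∃ G : SimpleGraph (Fin N), ∀ r : ℕ, HasEFOfSize (stabPolytope G) r →
      (3 / 2 : ℝ) ^ p ≤ r + 1 := by
  classical
  -- pad `H_p` with `N - 2p²` isolated vertices and relabel to `Fin N`
  have hcard : Fintype.card (Vert p ⊕ Fin (N - 2 * p ^ 2)) = N := by
    rw [Fintype.card_sum, card_vert_eq_two_mul_sq, Fintype.card_fin]
    omega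
  let e : Vert p ⊕ Fin (N - 2 * p ^ 2) ≃ Fin N := Fintype.equivFinOfCardEq hcard
  refine ⟨((graphH p).map (Sum.inl : Vert p → Vert p ⊕ Fin (N - 2 * p ^ 2))).map e,
    fun r hr => ?_⟩
  rw [stabPolytope_eq_stab, hasEFOfSize_stab_map_equiv_iff] at hr
  exact stab_graphH_xc_ge (hr.of_stab_map_inl _ _)

/-- **FMPTW Theorem 10**, `√`-form: for every `N` there is an `N`-vertex graph `G_N` with
`xc(STAB(G_N)) ≥ (3/2)^{⌊√(N/2)⌋} − 1 = 2^{Ω(√N)}`.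
[cite: FioriniEtAl2015, §3.3, Thm. 10 (arXiv p. 10)] -/
theorem FioriniEtAl2015_thm10_sqrt (N : ℕ) :
    ∃ G : SimpleGraph (Fin N), ∀ r : ℕ, HasEFOfSize (stabPolytope G) r →
      (3 / 2 : ℝ) ^ ⌊Real.sqrt ((N : ℝ) / 2)⌋₊ ≤ r + 1 := by
  apply FioriniEtAl2015_thm10
  set p := ⌊Real.sqrt ((N : ℝ) / 2)⌋₊ with hp
  have h0 : (0 : ℝ) ≤ (N : ℝ) / 2 := by positivity
  have h1 : (p : ℝ) ≤ Real.sqrt ((N : ℝ) / 2) := Nat.floor_le (Real.sqrt_nonneg _)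
  have h2 : (p : ℝ) ^ 2 ≤ (N : ℝ) / 2 := by
    calc (p : ℝ) ^ 2 ≤ Real.sqrt ((N : ℝ) / 2) ^ 2 := by gcongr
      _ = (N : ℝ) / 2 := Real.sq_sqrt h0
  have h3 : (2 * p ^ 2 : ℕ) ≤ (N : ℝ) := by push_cast; linarith
  exact_mod_cast h3

end Literature.Barriers.PneNP
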